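import Mathlib
import Summits.Schanuel.Schanuel.Theses.RelationCounting

/-!
# Line `birth` — BC3 skeleton for the crux `CountingGapPair` (stmt-Schanuel-16238)

Route `RelationCounting` (route-Schanuel-RelationCounting), crux (rank 3)
`Summit.Schanuel.Schanuel.Theses.RelationCounting.CountingGapPair` — the level `k = 1` counting gap:
for every strip height `b > 0` there are a width `M ≥ 3`, an exponent `κ < M − 2` and a constant `C`
such that for all large `T` the COUNTED POINTS `w ∈ ℂ^M` at complexity `T` (box `|Re wᵢ| ≤ T`,
`|Im wᵢ| ≤ b`; two `ℚ`-linearly independent coordinates; `s ≥ 2M − 1` integer relations of degree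
and height `≤ T` vanishing at `x = (w, e^w)` with `ℂ`-independent gradients, `M` of them a
non-degenerate Khovanskii system) number at most `⌊C·T^κ⌋`.

THE LINE (`real-span dichotomy`; registrar skeleton, no engine claimed). A counted point is a
counterexample to Schanuel AT RANK TWO: `s ≥ 2M − 1` relations with `ℂ`-independent gradients force
`trdeg ℚ(w, e^w) ≤ 2M − s ≤ 1` (Kähler differentials), while two coordinates are `ℚ`-independent.
So the level-1 count is a count of presentations of RANK-TWO FAILURES `z = (z₁, z₂)`
(`ℚ`-independent, `trdeg ℚ(z, e^z) ≤ 1`), and these come in exactly two geometric species, read off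
the real dimension (`1` or `2`) of the `ℝ`-span of the tuple `w` inside `ℂ = ℝ²`:

* COLLINEAR tuples — every coordinate is a real multiple of one complex number `u`
  (`∃ u, ∀ i, ∃ r : ℝ, wᵢ = r·u`); a `ℚ`-independent pair inside has REAL irrational ratio.
  Hypothetical instances this species contains: `(log 2, log 3)` (two logarithms of rationals
  algebraically dependent), `(1, e)` (`e`, `e^e` dependent), `(iπ, iπ√2)` (`π`, `e^{iπ√2}`
  dependent).  The width amplification `w = (z, Kz)`, `K ∈ ℤ^{(M−2)×2}`, of a collinear failure
  stays on the real line `uℝ` and CLUSTERS: `≍ T^{M−2}` counted points in a single unit cell of the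
  `Re`-box (and only `O_b(1)` cells are met at all when `u ∉ ℝ`).  One real parameter per
  coordinate: after the rotation `w = u·t`, `t ∈ ℝ^M`, this is counting on the REAL leaf
  `t ↦ (ut, e^{ut})` — `ℝ_exp`-definable for `u = 1` (no strip), restricted-analytic on a bounded
  `t`-region otherwise (Khovanskii / Wilkie territory).
* SPREAD tuples — the coordinates span `ℂ` over `ℝ`: some pair `(wᵢ, wⱼ)` is `ℝ`-independent, hence
  `ℚ`-independent with NON-REAL ratio.  Hypothetical instances: the route's `(1, πi)` cell (`e`, `π`
  dependent ⇒ the Gaussian-lattice ensemble `(1, πi, aᵣ + εᵣπi)`), `(log 2, πi)` (`π`, `log 2`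
  dependent).  The amplification of a spread failure is lattice-like in `ℝ² = ℂ`: `O_b(1)` counted
  points per unit cell but `≍ T^{M−2}` cells — all of its difficulty is the NUMBER OF CELLS met (the
  route's foreseen layer-2 node `UnitCellCluster`), none of it is clustering.

The skeleton files ONE STUB PER SPECIES, each the crux's own count restricted to the species (no new
definition: the species predicate is the first conjunct of the crux's set-builder, the rest verbatim):

* `stub_collinearGap` — for every `b > 0` and EVERY width `M ≥ 3`: `∃ κ < M − 2, ∃ C`, eventually
  `#{collinear counted points} ≤ ⌊C·T^κ⌋`.  Universal in `M` because the composition must serve the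
  width chosen by the spread stub; plausibility is unaffected (under Schanuel at rank 2 for
  real-ratio pairs the collinear ensemble is EMPTY in every width, for every `b` and `T`).
* `stub_spreadGap` — the crux's quantifier shape verbatim on the spread species: `∀ b > 0, ∃ M ≥ 3,
  ∃ κ < M − 2, ∃ C`, eventually `#{spread counted points} ≤ ⌊C·T^κ⌋`.  A CONSEQUENCE of the crux
  (`spreadGap_of_countingGapPair`, sorry-free: the species is a subset), hence exactly as safe as it.
* `CountingGapPair_of : stub₁-sig → stub₂-sig → CountingGapPair` — REAL proof: take the width `M` of
  the spread stub and the collinear stub at that width, `κ = max κ₁ κ₂ < M − 2`,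
  `C = max C₁ 0 + max C₂ 0`, and for `T ≥ 1` the union bound
  `encard ≤ ⌊C₁T^{κ₁}⌋ + ⌊C₂T^{κ₂}⌋ ≤ ⌊C·T^κ⌋` (`gap_of_regimes`, abstract in the counted predicate).
  `countingGapPair_of_stubs : CountingGapPair` applies it to the two stubs BY NAME.
* Sorry-free sandwich: `spreadGap_of_countingGapPair` (crux ⇒ stub 2) and
  `collinearGapAt_of_countingGapPair` (crux ⇒ the `∃ M` form of stub 1).

Content split (paper argument, `Lines/birth.md`): modulo the route's provable-now machinery
(relations ⇒ `trdeg ≤ 1`; `Amplification`, item stmt-Schanuel-16239),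
`stub_collinearGap ⟺ SC(2) for ℚ-independent pairs with real ratio` and
`stub_spreadGap ⟺ SC(2) for pairs with non-real ratio`; the crux itself `⟺ SC(2)` (`SchanuelTwo`,
stmt-Schanuel-0069).  Neither species gives the other, neither gives the crux alone, neither
mentions the summit; both are vacuous under Schanuel.  `sorry` occurs ONLY in the two `stub_*`.

References: G. Binyamini, H. Kawashima, M. Hirata-Kohno, N. Salant, arXiv:2604.15189, Conj. 1 and
§2.3 (relation counting); J. Pila, Ann. Inst. Fourier 60 (2010) 489–514, p. 493 (counting with a
uniform exponent ⇒ transcendence); M. Waldschmidt, *Diophantine approximation on linear algebraic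
groups* (2000), Conj. 1.14 (Schanuel), §1.4; A. Khovanskii, *Fewnomials* (1991), Ch. III (real
exponential systems); A. J. Wilkie, J. Amer. Math. Soc. 9 (1996) 1051–1094 (o-minimality of `ℝ_exp`);
S. Lang, *Introduction to transcendental numbers* (1966) pp. 30–31.
-/

-- `Summit.Schanuel.Schanuel.…`: the duplicated component is the mandated layout of this single-conjunct summit.
set_option linter.dupNamespace false

noncomputable section

namespace Summit.Schanuel.Schanuel.Cruxes.CountingGapPair.Birth

open Summit.Schanuel.Schanuel.Theses.RelationCounting

/-! ## The two registered OPEN stubs -/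

/-- **Stub 1 (collinear species, every width).**  For every strip height `b > 0` and every width
`M ≥ 3` there are `κ < M − 2` and `C` such that, for all large `T`, the counted points of `ℂ^M` at
level 1 and complexity `T` ALL OF WHOSE COORDINATES ARE REAL MULTIPLES OF ONE COMPLEX NUMBER
(`∃ u, ∀ i, ∃ r : ℝ, wᵢ = r·u` — the tuple lies on a real line through `0`) number at most `⌊C·T^κ⌋`.
Every such point carries a `ℚ`-independent pair with real irrational ratio and `trdeg ℚ(w, e^w) ≤ 1`,
so the stub is vacuous under Schanuel at rank 2 for real-ratio pairs; conversely the width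
amplification of such a pair is collinear and has `≫ T^{M−2}` members, so the stub is that fragment of
`SC(2)` in counting form (it contains the algebraic independence of `log 2, log 3`, of `e, e^e`, of
`π, e^{iπ√2}`).  Why it might fail: only with `SC(2)`; as a COUNTING statement the danger is
clustering — a collinear amplified family puts `≍ T^{M−2}` points into one unit cell, so no per-cell
`T^{o(1)}` bound can hold in this species and the exponent must come from the one-dimensional real
structure `w = u·t`, `t ∈ ℝ^M`. [cite: arXiv:2604.15189, Conj. 1; Waldschmidt2000, Conj. 1.14] -/
theorem stub_collinearGap :
    ∀ b : ℝ, 0 < b → ∀ M : ℕ, 3 ≤ M → ∃ κ : ℝ, κ < (M : ℝ) - 2 ∧ ∃ C : ℝ,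
      ∀ᶠ T : ℝ in Filter.atTop,
        ({w : Fin M → ℂ | (∃ u : ℂ, ∀ i, ∃ r : ℝ, w i = (r : ℂ) * u) ∧
          ((∀ i, |(w i).re| ≤ T ∧ |(w i).im| ≤ b) ∧
          (∃ f : Fin 2 ↪ Fin M, LinearIndependent ℚ (w ∘ f)) ∧
          ∃ (s : ℕ) (P : Fin s → MvPolynomial (Fin M ⊕ Fin M) ℤ) (e : Fin M ↪ Fin s),
            2 * M ≤ s + 1 ∧
            (∀ j, ((P j).totalDegree : ℝ) ≤ T ∧ ∀ mo, |(((P j).coeff mo : ℤ) : ℝ)| ≤ T) ∧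
            (∀ j, MvPolynomial.aeval (Sum.elim w (Complex.exp ∘ w)) (P j) = 0) ∧
            LinearIndependent ℂ (fun j => fun i : Fin M ⊕ Fin M =>
              MvPolynomial.aeval (Sum.elim w (Complex.exp ∘ w)) (MvPolynomial.pderiv i (P j))) ∧
            (Matrix.of fun i j : Fin M =>
              MvPolynomial.aeval (Sum.elim w (Complex.exp ∘ w))
                (MvPolynomial.pderiv (Sum.inl j) (P (e i)) +
                  MvPolynomial.X (Sum.inr j) * MvPolynomial.pderiv (Sum.inr j) (P (e i)))).det ≠ 0)
        }).encard ≤ ((⌊C * T ^ κ⌋₊ : ℕ) : ℕ∞) := by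
  sorry

/-- **Stub 2 (spread species, the crux's own quantifier shape).**  For every strip height `b > 0`
there are a width `M ≥ 3`, `κ < M − 2` and `C` such that, for all large `T`, the counted points of
`ℂ^M` at level 1 and complexity `T` WHOSE COORDINATES SPAN `ℂ` OVER `ℝ` (NOT all real multiples of
one complex number) number at most `⌊C·T^κ⌋`.  Such a point carries an `ℝ`-independent — hence
`ℚ`-independent, non-real-ratio — pair with `trdeg ℚ(w, e^w) ≤ 1`; the species contains the route's
`(1, πi)` cell (the Gaussian-lattice ensemble `(1, πi, aᵣ + εᵣπi)`, counted iff `e` and `π` are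
algebraically dependent) and `(log 2, πi)`.  A CONSEQUENCE of the crux (`spreadGap_of_countingGapPair`:
the species is a subset of the counted set), vacuous under Schanuel at rank 2 for non-real-ratio
pairs, and by width amplification equivalent to that fragment in counting form.  Why it might fail:
only with `SC(2)`; as a counting statement its whole difficulty is the NUMBER OF UNIT CELLS met
(amplified spread families have `O_b(1)` points per cell and meet `≍ T^{M−2}` cells), where nothing
is known beyond level 0 (Hermite–Lindemann). [cite: arXiv:2604.15189, Conj. 1; Pila2010, p. 493] -/
theorem stub_spreadGap :
    ∀ b : ℝ, 0 < b → ∃ M : ℕ, 3 ≤ M ∧ ∃ κ : ℝ, κ < (M : ℝ) - 2 ∧ ∃ C : ℝ,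
      ∀ᶠ T : ℝ in Filter.atTop,
        ({w : Fin M → ℂ | (¬ ∃ u : ℂ, ∀ i, ∃ r : ℝ, w i = (r : ℂ) * u) ∧
          ((∀ i, |(w i).re| ≤ T ∧ |(w i).im| ≤ b) ∧
          (∃ f : Fin 2 ↪ Fin M, LinearIndependent ℚ (w ∘ f)) ∧
          ∃ (s : ℕ) (P : Fin s → MvPolynomial (Fin M ⊕ Fin M) ℤ) (e : Fin M ↪ Fin s),
            2 * M ≤ s + 1 ∧
            (∀ j, ((P j).totalDegree : ℝ) ≤ T ∧ ∀ mo, |(((P j).coeff mo : ℤ) : ℝ)| ≤ T) ∧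
            (∀ j, MvPolynomial.aeval (Sum.elim w (Complex.exp ∘ w)) (P j) = 0) ∧
            LinearIndependent ℂ (fun j => fun i : Fin M ⊕ Fin M =>
              MvPolynomial.aeval (Sum.elim w (Complex.exp ∘ w)) (MvPolynomial.pderiv i (P j))) ∧
            (Matrix.of fun i j : Fin M =>
              MvPolynomial.aeval (Sum.elim w (Complex.exp ∘ w))
                (MvPolynomial.pderiv (Sum.inl j) (P (e i)) +
                  MvPolynomial.X (Sum.inr j) * MvPolynomial.pderiv (Sum.inr j) (P (e i)))).det ≠ 0)
        }).encard ≤ ((⌊C * T ^ κ⌋₊ : ℕ) : ℕ∞) := by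
  sorry

/-! ## Sorry-free glue: floors, powers, and the union bound over the two species -/

/-- Floor bookkeeping: `⌊a⌋₊ + ⌊c⌋₊ ≤ ⌊a' + c'⌋₊` when `a ≤ a'`, `c ≤ c'` and `a', c' ≥ 0`. [folklore] -/
theorem floor_add_floor_le {a a' c c' : ℝ} (ha : a ≤ a') (hc : c ≤ c') (ha' : 0 ≤ a')
    (hc' : 0 ≤ c') : ⌊a⌋₊ + ⌊c⌋₊ ≤ ⌊a' + c'⌋₊ := by
  apply Nat.le_floor
  push_cast
  have h1 : (⌊a⌋₊ : ℝ) ≤ a' := by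
    rcases le_or_gt 0 a with h | h
    · exact (Nat.floor_le h).trans ha
    · rw [Nat.floor_of_nonpos h.le]
      simpa using ha'
  have h2 : (⌊c⌋₊ : ℝ) ≤ c' := by
    rcases le_or_gt 0 c with h | h
    · exact (Nat.floor_le h).trans hc
    · rw [Nat.floor_of_nonpos h.le]
      simpa using hc'
  linarith

/-- Power bookkeeping: for `T ≥ 1` and `κ ≤ κ'`, `C·T^κ ≤ max(C,0)·T^{κ'}`. [folklore] -/
theorem mul_rpow_le_max_mul_rpow {C κ κ' T : ℝ} (hT : 1 ≤ T) (hκ : κ ≤ κ') :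
    C * T ^ κ ≤ max C 0 * T ^ κ' := by
  have hTpos : 0 < T := by linarith
  rcases le_or_gt C 0 with hC | hC
  · rw [max_eq_right hC, zero_mul]
    exact mul_nonpos_of_nonpos_of_nonneg hC (Real.rpow_pos_of_pos hTpos κ).le
  · rw [max_eq_left hC.le]
    exact mul_le_mul_of_nonneg_left (Real.rpow_le_rpow_of_exponent_le hT hκ) hC.le

/-- **The union bound over a dichotomy (sorry-free).**  If the points of an ensemble `{w | Q T w}`
satisfying a predicate `R` are eventually `≤ ⌊C₁T^{κ₁}⌋` and those violating `R` eventually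
`≤ ⌊C₂T^{κ₂}⌋`, then the whole ensemble is eventually `≤ ⌊(max C₁ 0 + max C₂ 0)·T^{max κ₁ κ₂}⌋`.
[folklore] -/
theorem gap_of_regimes {α : Type*} (Q : ℝ → α → Prop) (R : α → Prop) {κ₁ κ₂ C₁ C₂ : ℝ}
    (h₁ : ∀ᶠ T : ℝ in Filter.atTop,
      ({w | R w ∧ Q T w}).encard ≤ ((⌊C₁ * T ^ κ₁⌋₊ : ℕ) : ℕ∞))
    (h₂ : ∀ᶠ T : ℝ in Filter.atTop,
      ({w | (¬ R w) ∧ Q T w}).encard ≤ ((⌊C₂ * T ^ κ₂⌋₊ : ℕ) : ℕ∞)) :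
    ∀ᶠ T : ℝ in Filter.atTop,
      ({w | Q T w}).encard ≤ ((⌊(max C₁ 0 + max C₂ 0) * T ^ (max κ₁ κ₂)⌋₊ : ℕ) : ℕ∞) := by
  filter_upwards [h₁, h₂, Filter.eventually_ge_atTop (1 : ℝ)] with T hT₁ hT₂ hT
  have hsub : {w | Q T w} ⊆ {w | R w ∧ Q T w} ∪ {w | (¬ R w) ∧ Q T w} := by
    intro w hw
    by_cases h : R w
    · exact Or.inl ⟨h, hw⟩
    · exact Or.inr ⟨h, hw⟩
  have hfloor : ⌊C₁ * T ^ κ₁⌋₊ + ⌊C₂ * T ^ κ₂⌋₊ ≤ ⌊(max C₁ 0 + max C₂ 0) * T ^ (max κ₁ κ₂)⌋₊ := by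
    rw [add_mul]
    exact floor_add_floor_le (mul_rpow_le_max_mul_rpow hT (le_max_left _ _))
      (mul_rpow_le_max_mul_rpow hT (le_max_right _ _))
      (mul_nonneg (le_max_right _ _) (Real.rpow_nonneg (by linarith) _))
      (mul_nonneg (le_max_right _ _) (Real.rpow_nonneg (by linarith) _))
  calc ({w | Q T w}).encard
      ≤ ({w | R w ∧ Q T w} ∪ {w | (¬ R w) ∧ Q T w}).encard := Set.encard_le_encard hsub
    _ ≤ ({w | R w ∧ Q T w}).encard + ({w | (¬ R w) ∧ Q T w}).encard := Set.encard_union_le _ _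
    _ ≤ ((⌊C₁ * T ^ κ₁⌋₊ : ℕ) : ℕ∞) + ((⌊C₂ * T ^ κ₂⌋₊ : ℕ) : ℕ∞) := add_le_add hT₁ hT₂
    _ = ((⌊C₁ * T ^ κ₁⌋₊ + ⌊C₂ * T ^ κ₂⌋₊ : ℕ) : ℕ∞) := by push_cast; rfl
    _ ≤ ((⌊(max C₁ 0 + max C₂ 0) * T ^ (max κ₁ κ₂)⌋₊ : ℕ) : ℕ∞) := by exact_mod_cast hfloor

/-! ## The composition: the two stubs prove the crux BY NAME -/

/-- **THE SKELETON THEOREM (sorry-free).**  Collinear-species bound in every width + spread-species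
bound in some width ⇒ the crux `Summit.Schanuel.Schanuel.Theses.RelationCounting.CountingGapPair`:
at the width `M` supplied by the spread stub, `κ = max κ₁ κ₂ < M − 2`, `C = max C₁ 0 + max C₂ 0`,
union bound `gap_of_regimes`. [folklore] -/
theorem CountingGapPair_of :
    (∀ b : ℝ, 0 < b → ∀ M : ℕ, 3 ≤ M → ∃ κ : ℝ, κ < (M : ℝ) - 2 ∧ ∃ C : ℝ,
      ∀ᶠ T : ℝ in Filter.atTop,
        ({w : Fin M → ℂ | (∃ u : ℂ, ∀ i, ∃ r : ℝ, w i = (r : ℂ) * u) ∧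
          ((∀ i, |(w i).re| ≤ T ∧ |(w i).im| ≤ b) ∧
          (∃ f : Fin 2 ↪ Fin M, LinearIndependent ℚ (w ∘ f)) ∧
          ∃ (s : ℕ) (P : Fin s → MvPolynomial (Fin M ⊕ Fin M) ℤ) (e : Fin M ↪ Fin s),
            2 * M ≤ s + 1 ∧
            (∀ j, ((P j).totalDegree : ℝ) ≤ T ∧ ∀ mo, |(((P j).coeff mo : ℤ) : ℝ)| ≤ T) ∧
            (∀ j, MvPolynomial.aeval (Sum.elim w (Complex.exp ∘ w)) (P j) = 0) ∧
            LinearIndependent ℂ (fun j => fun i : Fin M ⊕ Fin M =>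
              MvPolynomial.aeval (Sum.elim w (Complex.exp ∘ w)) (MvPolynomial.pderiv i (P j))) ∧
            (Matrix.of fun i j : Fin M =>
              MvPolynomial.aeval (Sum.elim w (Complex.exp ∘ w))
                (MvPolynomial.pderiv (Sum.inl j) (P (e i)) +
                  MvPolynomial.X (Sum.inr j) * MvPolynomial.pderiv (Sum.inr j) (P (e i)))).det ≠ 0)
        }).encard ≤ ((⌊C * T ^ κ⌋₊ : ℕ) : ℕ∞)) →
    (∀ b : ℝ, 0 < b → ∃ M : ℕ, 3 ≤ M ∧ ∃ κ : ℝ, κ < (M : ℝ) - 2 ∧ ∃ C : ℝ,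
      ∀ᶠ T : ℝ in Filter.atTop,
        ({w : Fin M → ℂ | (¬ ∃ u : ℂ, ∀ i, ∃ r : ℝ, w i = (r : ℂ) * u) ∧
          ((∀ i, |(w i).re| ≤ T ∧ |(w i).im| ≤ b) ∧
          (∃ f : Fin 2 ↪ Fin M, LinearIndependent ℚ (w ∘ f)) ∧
          ∃ (s : ℕ) (P : Fin s → MvPolynomial (Fin M ⊕ Fin M) ℤ) (e : Fin M ↪ Fin s),
            2 * M ≤ s + 1 ∧
            (∀ j, ((P j).totalDegree : ℝ) ≤ T ∧ ∀ mo, |(((P j).coeff mo : ℤ) : ℝ)| ≤ T) ∧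
            (∀ j, MvPolynomial.aeval (Sum.elim w (Complex.exp ∘ w)) (P j) = 0) ∧
            LinearIndependent ℂ (fun j => fun i : Fin M ⊕ Fin M =>
              MvPolynomial.aeval (Sum.elim w (Complex.exp ∘ w)) (MvPolynomial.pderiv i (P j))) ∧
            (Matrix.of fun i j : Fin M =>
              MvPolynomial.aeval (Sum.elim w (Complex.exp ∘ w))
                (MvPolynomial.pderiv (Sum.inl j) (P (e i)) +
                  MvPolynomial.X (Sum.inr j) * MvPolynomial.pderiv (Sum.inr j) (P (e i)))).det ≠ 0)
        }).encard ≤ ((⌊C * T ^ κ⌋₊ : ℕ) : ℕ∞)) →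
    CountingGapPair := by
  intro hcol hspr b hb
  obtain ⟨M, hM, κ₂, hκ₂, C₂, h₂⟩ := hspr b hb
  obtain ⟨κ₁, hκ₁, C₁, h₁⟩ := hcol b hb M hM
  exact ⟨M, hM, max κ₁ κ₂, max_lt hκ₁ hκ₂, max C₁ 0 + max C₂ 0,
    gap_of_regimes _ (fun w : Fin M → ℂ => ∃ u : ℂ, ∀ i, ∃ r : ℝ, w i = (r : ℂ) * u) h₁ h₂⟩

/-- The crux, concluded BY NAME from the two declared stubs (closed only up to their `sorry`s).
[folklore] -/
theorem countingGapPair_of_stubs : CountingGapPair :=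
  CountingGapPair_of stub_collinearGap stub_spreadGap

/-! ## Sorry-free sandwich: both species bounds (at the crux's width) are consequences of the crux -/

/-- **The crux implies stub 2.**  The spread species is a subset of the counted set, so the crux's
width, exponent and constant serve verbatim. [folklore] -/
theorem spreadGap_of_countingGapPair (h : CountingGapPair) :
    ∀ b : ℝ, 0 < b → ∃ M : ℕ, 3 ≤ M ∧ ∃ κ : ℝ, κ < (M : ℝ) - 2 ∧ ∃ C : ℝ,
      ∀ᶠ T : ℝ in Filter.atTop,
        ({w : Fin M → ℂ | (¬ ∃ u : ℂ, ∀ i, ∃ r : ℝ, w i = (r : ℂ) * u) ∧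
          ((∀ i, |(w i).re| ≤ T ∧ |(w i).im| ≤ b) ∧
          (∃ f : Fin 2 ↪ Fin M, LinearIndependent ℚ (w ∘ f)) ∧
          ∃ (s : ℕ) (P : Fin s → MvPolynomial (Fin M ⊕ Fin M) ℤ) (e : Fin M ↪ Fin s),
            2 * M ≤ s + 1 ∧
            (∀ j, ((P j).totalDegree : ℝ) ≤ T ∧ ∀ mo, |(((P j).coeff mo : ℤ) : ℝ)| ≤ T) ∧
            (∀ j, MvPolynomial.aeval (Sum.elim w (Complex.exp ∘ w)) (P j) = 0) ∧
            LinearIndependent ℂ (fun j => fun i : Fin M ⊕ Fin M =>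
              MvPolynomial.aeval (Sum.elim w (Complex.exp ∘ w)) (MvPolynomial.pderiv i (P j))) ∧
            (Matrix.of fun i j : Fin M =>
              MvPolynomial.aeval (Sum.elim w (Complex.exp ∘ w))
                (MvPolynomial.pderiv (Sum.inl j) (P (e i)) +
                  MvPolynomial.X (Sum.inr j) * MvPolynomial.pderiv (Sum.inr j) (P (e i)))).det ≠ 0)
        }).encard ≤ ((⌊C * T ^ κ⌋₊ : ℕ) : ℕ∞) := by
  intro b hb
  obtain ⟨M, hM, κ, hκ, C, hC⟩ := h b hb
  refine ⟨M, hM, κ, hκ, C, ?_⟩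
  filter_upwards [hC] with T hT
  exact (Set.encard_le_encard fun w hw => hw.2).trans hT

/-- **The crux implies the single-width form of stub 1.**  The collinear species is a subset of the
counted set; only the universal quantification over the width `M` in `stub_collinearGap` goes beyond
the crux. [folklore] -/
theorem collinearGapAt_of_countingGapPair (h : CountingGapPair) :
    ∀ b : ℝ, 0 < b → ∃ M : ℕ, 3 ≤ M ∧ ∃ κ : ℝ, κ < (M : ℝ) - 2 ∧ ∃ C : ℝ,
      ∀ᶠ T : ℝ in Filter.atTop,
        ({w : Fin M → ℂ | (∃ u : ℂ, ∀ i, ∃ r : ℝ, w i = (r : ℂ) * u) ∧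
          ((∀ i, |(w i).re| ≤ T ∧ |(w i).im| ≤ b) ∧
          (∃ f : Fin 2 ↪ Fin M, LinearIndependent ℚ (w ∘ f)) ∧
          ∃ (s : ℕ) (P : Fin s → MvPolynomial (Fin M ⊕ Fin M) ℤ) (e : Fin M ↪ Fin s),
            2 * M ≤ s + 1 ∧
            (∀ j, ((P j).totalDegree : ℝ) ≤ T ∧ ∀ mo, |(((P j).coeff mo : ℤ) : ℝ)| ≤ T) ∧
            (∀ j, MvPolynomial.aeval (Sum.elim w (Complex.exp ∘ w)) (P j) = 0) ∧
            LinearIndependent ℂ (fun j => fun i : Fin M ⊕ Fin M =>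
              MvPolynomial.aeval (Sum.elim w (Complex.exp ∘ w)) (MvPolynomial.pderiv i (P j))) ∧
            (Matrix.of fun i j : Fin M =>
              MvPolynomial.aeval (Sum.elim w (Complex.exp ∘ w))
                (MvPolynomial.pderiv (Sum.inl j) (P (e i)) +
                  MvPolynomial.X (Sum.inr j) * MvPolynomial.pderiv (Sum.inr j) (P (e i)))).det ≠ 0)
        }).encard ≤ ((⌊C * T ^ κ⌋₊ : ℕ) : ℕ∞) := by
  intro b hb
  obtain ⟨M, hM, κ, hκ, C, hC⟩ := h b hb
  refine ⟨M, hM, κ, hκ, C, ?_⟩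
  filter_upwards [hC] with T hT
  exact (Set.encard_le_encard fun w hw => hw.2).trans hT

end Summit.Schanuel.Schanuel.Cruxes.CountingGapPair.Birth

end
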